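import Literature.NumberTheory.LFunctions.PatelYangBlockSums
import HarnessLib

/-!
# Patel–Yang's Lemma 3.3 per block in monomial form

Topic `Literature/NumberTheory/LFunctions`. Patel–Yang 2024, Lemma 3.3 (the middle range, explicit
fourth-derivative test `k = 4`, `K = 8`): from
`Literature.NumberTheory.LFunctions.VdC.midBlock_cpow_le` and
`yangKRHS η h⁴ 4 N λ₄ = A₄ h N λ₄^{1/14} + B₄ N^{3/4} λ₄^{-1/14}` with `N = (h-1)a`,
`λ₄ = 3t/(π(ha)⁴)` we PROVE, for naturals `1 ≤ a`, `b ≤ ha`,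
`‖∑_{a<n≤b} n^{-(1/2+it)}‖ ≤ D₃ a^{3/14} t^{1/14} + D₄ a^{15/28} t^{-1/14}`,
`D₃ = A₄(η, h⁴)(h-1)h^{5/7}(3/π)^{1/14}`, `D₄ = B₄(η)(h-1)^{3/4}h^{2/7}(3/π)^{-1/14}`
(Patel–Yang's `D₃ a^{3/14}t^{1/14} + D₄ a^{15/28}t^{-1/14}`, proof of Lemma 3.3).

## References

* D. Patel, A. Yang, *An explicit sub-Weyl bound for `ζ(1/2 + it)`*, J. Number Theory 262 (2024),
  Lemma 3.3. [cite: PatelYang2024, Lemma 3.3]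
-/

noncomputable section

open Real Set

namespace Literature.NumberTheory.LFunctions
namespace VdC

/-- The order-`4` right-hand side of Yang's test: `K = 8`, exponents `2/K = 1/4`, `1/(2K-2) = 1/14`,
`1 - 2/K = 3/4`. [cite: PatelYang2024, Lemma 1.4] -/
theorem yangKRHS_four (η H N lam : ℝ) :
    yangKRHS η H 4 N lam = yangA η H 4 * H ^ (1 / 4 : ℝ) * N * lam ^ (1 / 14 : ℝ)
      + yangB η 4 * N ^ (3 / 4 : ℝ) * lam ^ (-(1 / 14 : ℝ)) := by
  unfold yangKRHS
  have hJ : yangJ 4 = 8 := by rw [yangJ]; norm_num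
  rw [hJ]
  norm_num

set_option maxHeartbeats 800000 in
/-- **Patel–Yang's Lemma 3.3 per block**: for `t > 0`, `1 < h`, `η > 0`, naturals `1 ≤ a`,
`b ≤ ha`: `‖∑_{a<n≤b} n^{-(1/2+it)}‖ ≤ D₃ a^{3/14}t^{1/14} + D₄ a^{15/28}t^{-1/14}` with
`D₃ = A₄(η,h⁴)(h-1)h^{5/7}(3/π)^{1/14}`, `D₄ = B₄(η)(h-1)^{3/4}h^{2/7}(3/π)^{-1/14}`.
[cite: PatelYang2024, Lemma 3.3] -/
theorem midBlock_phi_le {t h η : ℝ} (ht : 0 < t) (hh1 : 1 < h) (hη : 0 < η) {a b : ℕ}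
    (ha : 1 ≤ a) (hb : (b : ℝ) ≤ h * a) :
    ‖∑ n ∈ Finset.Ioc a b, (n : ℂ) ^ (-((1 / 2 : ℂ) + t * Complex.I))‖
      ≤ yangA η (h ^ 4) 4 * (h - 1) * h ^ (5 / 7 : ℝ) * (3 / π) ^ (1 / 14 : ℝ)
          * (a : ℝ) ^ (3 / 14 : ℝ) * t ^ (1 / 14 : ℝ)
        + yangB η 4 * (h - 1) ^ (3 / 4 : ℝ) * h ^ (2 / 7 : ℝ) * (3 / π) ^ (-(1 / 14 : ℝ))
          * (a : ℝ) ^ (15 / 28 : ℝ) * t ^ (-(1 / 14 : ℝ)) := by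
  have hπ := Real.pi_pos
  have hh0 : 0 < h := by linarith
  have hh1' : 0 ≤ h - 1 := by linarith
  have ha0 : (0 : ℝ) < a := by exact_mod_cast (show 0 < a by omega)
  refine (midBlock_cpow_le (η := η) ht hh1 hη ha hb).trans (le_of_eq ?_)
  rw [yangKRHS_four]
  -- root variables `a = U²⁸`, `h = V²⁸`, `t = W²⁸`
  obtain ⟨U, hU0, hUa⟩ : ∃ U : ℝ, 0 < U ∧ U ^ 28 = (a : ℝ) :=
    ⟨(a : ℝ) ^ (1 / 28 : ℝ), Real.rpow_pos_of_pos ha0 _, by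
      rw [← Real.rpow_natCast, ← Real.rpow_mul ha0.le]; norm_num⟩
  obtain ⟨V, hV0, hVh⟩ : ∃ V : ℝ, 0 < V ∧ V ^ 28 = h :=
    ⟨h ^ (1 / 28 : ℝ), Real.rpow_pos_of_pos hh0 _, by
      rw [← Real.rpow_natCast, ← Real.rpow_mul hh0.le]; norm_num⟩
  obtain ⟨W, hW0, hWt⟩ : ∃ W : ℝ, 0 < W ∧ W ^ 28 = t :=
    ⟨t ^ (1 / 28 : ℝ), Real.rpow_pos_of_pos ht _, by
      rw [← Real.rpow_natCast, ← Real.rpow_mul ht.le]; norm_num⟩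
  -- the pieces
  have e1 : (h ^ 4) ^ (1 / 4 : ℝ) = h := by
    rw [rpow_pow_natCast' hh0.le 4 1 (by norm_num), pow_one]
  have e2 : ((h - 1) * (a : ℝ)) ^ (3 / 4 : ℝ) = (h - 1) ^ (3 / 4 : ℝ) * U ^ 21 := by
    rw [Real.mul_rpow hh1' ha0.le, ← hUa, rpow_pow_natCast' hU0.le 28 21 (by norm_num)]
  have hlam : 6 * (t / (2 * π)) / (h * (a : ℝ)) ^ 4 = (3 / π) * W ^ 28 / (V * U) ^ 112 := by
    rw [← hUa, ← hVh, ← hWt]; field_simp; ring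
  have e3 : (6 * (t / (2 * π)) / (h * (a : ℝ)) ^ 4) ^ (1 / 14 : ℝ) = (3 / π) ^ (1 / 14 : ℝ) * W ^ 2 / (V * U) ^ 8 := by
    rw [hlam]; exact rpow_monomial (by positivity) hW0.le (by positivity) 28 112 2 8 (by norm_num) (by norm_num)
  have e4 : (6 * (t / (2 * π)) / (h * (a : ℝ)) ^ 4) ^ (-(1 / 14 : ℝ))
      = (3 / π) ^ (-(1 / 14 : ℝ)) * (V * U) ^ 8 / W ^ 2 := by
    rw [Real.rpow_neg (by positivity), e3, Real.rpow_neg (by positivity)]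
    field_simp
  have e5 : (a : ℝ) ^ (-(1 / 2 : ℝ)) = (U ^ 14)⁻¹ := by
    rw [← hUa]; exact rpow_pow_neg' hU0.le 28 14 (by norm_num)
  have e6 : h ^ (5 / 7 : ℝ) = V ^ 20 := by rw [← hVh]; exact rpow_pow_natCast' hV0.le 28 20 (by norm_num)
  have e7 : h ^ (2 / 7 : ℝ) = V ^ 8 := by rw [← hVh]; exact rpow_pow_natCast' hV0.le 28 8 (by norm_num)
  have e8 : (a : ℝ) ^ (3 / 14 : ℝ) = U ^ 6 := by rw [← hUa]; exact rpow_pow_natCast' hU0.le 28 6 (by norm_num)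
  have e9 : (a : ℝ) ^ (15 / 28 : ℝ) = U ^ 15 := by rw [← hUa]; exact rpow_pow_natCast' hU0.le 28 15 (by norm_num)
  have e10 : t ^ (1 / 14 : ℝ) = W ^ 2 := by rw [← hWt]; exact rpow_pow_natCast' hW0.le 28 2 (by norm_num)
  have e11 : t ^ (-(1 / 14 : ℝ)) = (W ^ 2)⁻¹ := by rw [← hWt]; exact rpow_pow_neg' hW0.le 28 2 (by norm_num)
  rw [e1, e2, e3, e4, e5, e6, e7, e8, e9, e10, e11]
  -- remaining occurrences of `h` and `a` as plain factors
  have hc : (3 / π : ℝ) ^ (1 / 14 : ℝ) ≠ 0 := (Real.rpow_pos_of_pos (by positivity) _).ne'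
  rw [← hUa, ← hVh]
  field_simp

end VdC
end Literature.NumberTheory.LFunctions
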